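import Summits.CriticalPhenomena.PercolationContinuityZ3.Theorems.PercNearOneGluingNoHeavyQuantGateMoveBlob
import HarnessLib

/-!
# QUANT lane R8, T-DEC, leg (III): the LOW-TO-ZERO MOVE from a flow datum — two datum-form criteria for an ARBITRARY law,
# without the "no unshifted atom below the blob" hypothesis (typer g28, part 1 of 2)

builds on p205010 (kernel theorem, internal audit signed; external expert review pending)

Support file (`--supports stmt-CriticalPhenomena-4575`), QUANT lane typer seat prim-quant-stmt (gen 28), rung R8 of
`run/shared/lean/prim/quant/LADDER.md`.  Theorems only, standard axioms, no sorries, no definitions.  Continues typer g27's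
`…QuantGateMoveBlob` ((M): `slice (gate_q μ) a g ⟶ gate_q (slice μ a g)`, proved there under `hsupp`).  Part 2: `…QuantGateMoveBlobDatum`.

THE MOVE.  A law `L` on `{0..N}` with a flow datum `f` at `(y, τ, j)`; an atom `a` that is a LOW of the smaller target `t ≤ τ`
(`a ≤ j`, `2a < t`); the moved law `P = L + ε(δ₀ − δ_a)`.  Two criteria for `P ∈ FlowAtT(y, t, j)` (no slice structure, nothing
assumed about the atoms strictly between `0` and `a`):
* **`LawDec.flowAtT_lowToZero_of_giantBound`** — if `f` ships at least `ε` of the atom `a` to the GIANTS: hand that giant flow to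
  the atom `0` (same giants, same rate `y/(1−y)`); every other `t`-low keeps its pairs (`usage_le_of_target_le`).  Needs `t ≤ τ`,
  `0 ≤ ε`, `L ≥ 0` only.
* **`LawDec.flowAtT_lowToZero_of_midAbsorbed`** — if every NONZERO `t`-low other than `a` ships into mids only and `a` ships at most
  `ε ≤ L a` to the giants: keep the mid pairs of the nonzero `t`-lows (those of `a` scaled to its new mass `L a − ε`) and finish with
  the first-moment criterion on the remainder (`gateMoveBlob_remainder` + `flowAtT_of_moment`, its only charged low being `0`).
  Needs `P` a probability law of mean `t` with `y·N ≤ t` (in (M): `t = τ − zag`, from TA of `ν` and `y ≤ (1−z)g`).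
Memo: `run/shared/lean/prim/quant/prim-quant-stmt-g28/GATE-MOVE-G28.md`.  HONEST STATUS: (M) for general `a`, `GateMove`,
`GatedConvEmptyFree`, `SingleGateConvClosed`, `SDECConvClosed`, `TreeDEC`, `FarTreeRow` remain OPEN.

[this work]; flow normal form typer g22 / lead g21, criteria typer g26, (M) typer g27 (this lane).  The gluing rows served
[cite: KozmaNitzan2024, Conjecture 3 (p. 15)]; product measure [cite: Grimmett1999, §1.3 p. 10].
-/

noncomputable section

namespace Summit.CriticalPhenomena.PercolationContinuityZ3.Theorems

namespace Quant

open Finset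

namespace LawDec

/-! ### Rates at a smaller target -/

/-- **a pair charged at target `τ` is no dearer at a smaller target `t ≤ τ`**: for `0 < y < 1`, a low `l` of `t` (`2l < t`),
`l < h`, and `h` a giant or `τ`-compatible (`τ < l + h`), `usage y t j l h ≤ usage y τ j l h`. [this work] -/
theorem usage_le_of_target_le (y t τ : ℝ) (j l h : ℕ) (hy0 : 0 < y) (hy1 : y < 1) (htτ : t ≤ τ)
    (hlow : 2 * (l : ℝ) < t) (hlh : l < h) (hc : j + 1 ≤ h ∨ τ < (l : ℝ) + h) :
    usage y t j l h ≤ usage y τ j l h := by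
  by_cases hg : j + 1 ≤ h
  · rw [usage_giant_eq y t j l h hg, usage_giant_eq y τ j l h hg]
  · have hhj : h ≤ j := by omega
    have hc' : τ < (l : ℝ) + h := hc.resolve_left hg
    exact usage_le_of_rho_le y t τ j l l h hy0 hy1 hhj (by linarith) hc' (rho_le_of_target_le t τ l h hlh htτ)

/-! ### Criterion 1: the atom `a` has giant-bound mass `≥ ε` -/

/-- **THE LOW-TO-ZERO MOVE WHEN `a` HAS GIANT-BOUND MASS `≥ ε`.**  `0 < y < 1`, `t ≤ τ`, `0 ≤ ε`; `L ≥ 0` with a flow datum `f`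
at `(y, τ, j)` on `{0..N}`; `a ≤ j`, `2a < t`, and `ε ≤ Σ_{j < h ≤ N} f a h`.  Then `L + ε(δ₀ − δ_a)` has a flow at `(y, t, j)`:
the fraction `ε / Σ_giants f a h` of each giant pair of `a` is handed to the atom `0` (same giant, same rate), every other pair of a
`t`-low is kept. [this work] -/
theorem flowAtT_lowToZero_of_giantBound (y τ t ε : ℝ) (a j N : ℕ) (L : ℕ → ℝ) (f : ℕ → ℕ → ℝ)
    (hy0 : 0 < y) (hy1 : y < 1) (htτ : t ≤ τ) (hε0 : 0 ≤ ε) (haj : a ≤ j) (hat : 2 * (a : ℝ) < t)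
    (hL0 : ∀ h, 0 ≤ L h) (hf : IsFlowAtT y τ j N L f)
    (hGa : ε ≤ ∑ h ∈ Finset.Ico (j + 1) (N + 1), f a h) :
    FlowAtT y t j N (fun h => L h + ε * ((if h = 0 then (1 : ℝ) else 0) - (if h = a then (1 : ℝ) else 0))) := by
  classical
  obtain ⟨hf0, hfsupp, hfrow, hfcap⟩ := hf
  set Ga : ℝ := ∑ h ∈ Finset.Ico (j + 1) (N + 1), f a h with hGa_def
  have hGa0 : 0 ≤ Ga := Finset.sum_nonneg fun h _ => hf0 a h
  -- the transferred fraction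
  obtain ⟨θ, hθ0, hθ1, hθG⟩ : ∃ θ : ℝ, 0 ≤ θ ∧ θ ≤ 1 ∧ θ * Ga = ε := by
    rcases hGa0.eq_or_lt with hz | hpos
    · refine ⟨0, le_rfl, zero_le_one, ?_⟩
      have : ε = 0 := le_antisymm (by rw [hz]; exact hGa) hε0
      rw [this, zero_mul]
    · exact ⟨ε / Ga, div_nonneg hε0 hGa0, (div_le_one hpos).2 hGa, div_mul_cancel₀ ε hpos.ne'⟩
  -- the new flow
  refine ⟨fun l h => if (l ≤ j ∧ 2 * (l : ℝ) < t) then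
      f l h + (if j + 1 ≤ h then θ * f a h * ((if l = 0 then (1 : ℝ) else 0) - (if l = a then (1 : ℝ) else 0)) else 0)
      else 0, ?_, ?_, ?_, ?_⟩
  · -- nonnegativity
    intro l h
    beta_reduce
    by_cases hl : l ≤ j ∧ 2 * (l : ℝ) < t
    · rw [if_pos hl]
      by_cases hg : j + 1 ≤ h
      · rw [if_pos hg]
        by_cases hl0 : l = 0
        · rw [if_pos hl0]
          split_ifs <;> nlinarith [hf0 l h, hf0 a h, mul_nonneg hθ0 (hf0 a h)]
        · rw [if_neg hl0]
          by_cases hla : l = a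
          · rw [if_pos hla, hla]
            nlinarith [hf0 a h, mul_nonneg (sub_nonneg.2 hθ1) (hf0 a h)]
          · rw [if_neg hla]
            nlinarith [hf0 l h]
      · rw [if_neg hg, add_zero]
        exact hf0 l h
    · rw [if_neg hl]
  · -- support
    intro l h hp
    beta_reduce at hp
    by_cases hl : l ≤ j ∧ 2 * (l : ℝ) < t
    · rw [if_pos hl] at hp
      refine ⟨hl.1, hl.2, ?_⟩
      by_cases hg : j + 1 ≤ h
      · rw [if_pos hg] at hp
        refine ⟨?_, Or.inl hg⟩
        by_contra hN
        have hN' : N < h := not_le.1 hN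
        have hzN : ∀ l', f l' h = 0 := fun l' => by
          by_contra hne
          exact absurd (hfsupp l' h (lt_of_le_of_ne (hf0 l' h) (Ne.symm hne))).2.2.1 (by omega)
        rw [hzN l, hzN a] at hp
        simp at hp
      · rw [if_neg hg, add_zero] at hp
        obtain ⟨_, _, hhN, hc⟩ := hfsupp l h hp
        refine ⟨hhN, ?_⟩
        rcases hc with hc | hc
        · exact Or.inl hc
        · exact Or.inr (by linarith)
    · rw [if_neg hl] at hp
      exact absurd hp (lt_irrefl _)
  · -- rows
    intro l hlj hlow
    beta_reduce
    simp only [if_pos (show l ≤ j ∧ 2 * (l : ℝ) < t from ⟨hlj, hlow⟩)]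
    rw [Finset.sum_add_distrib, hfrow l hlj (by linarith)]
    have e : ∑ h ∈ Finset.range (N + 1),
        (if j + 1 ≤ h then θ * f a h * ((if l = 0 then (1 : ℝ) else 0) - (if l = a then (1 : ℝ) else 0)) else 0)
        = θ * Ga * ((if l = 0 then (1 : ℝ) else 0) - (if l = a then (1 : ℝ) else 0)) := by
      have e1 : ∀ h ∈ Finset.range (N + 1),
          (if j + 1 ≤ h then θ * f a h * ((if l = 0 then (1 : ℝ) else 0) - (if l = a then (1 : ℝ) else 0)) else 0)
          = (if j + 1 ≤ h then f a h else 0) * (θ * ((if l = 0 then (1 : ℝ) else 0) - (if l = a then (1 : ℝ) else 0))) := by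
        intro h _
        split_ifs <;> ring
      rw [Finset.sum_congr rfl e1, ← Finset.sum_mul, sum_range_ite_ge_eq_Ico]
      ring
    rw [e, hθG]
  · -- loads
    intro h hhN habs
    beta_reduce
    -- an absorber of `t` is neither `0` nor `a`
    have hh0 : h ≠ 0 := by
      rintro rfl
      rcases habs with h1 | h1
      · omega
      · push_cast at h1; linarith
    have hha : h ≠ a := by
      rintro rfl
      rcases habs with h1 | h1
      · omega
      · linarith
    rw [if_neg hh0, if_neg hha, sub_zero, mul_zero, add_zero]
    by_cases hg : j + 1 ≤ h
    · -- a giant: the rate is the floor rate for every low; the transfer from `a` to `0` is load-neutral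
      have hu : ∀ l, usage y t j l h = y / (1 - y) := fun l => usage_giant_eq y t j l h hg
      have hu' : ∀ l, usage y τ j l h = y / (1 - y) := fun l => usage_giant_eq y τ j l h hg
      simp only [hu, if_pos hg]
      rw [← Finset.mul_sum]
      have hcap := hfcap h hhN (Or.inl hg)
      simp only [hu'] at hcap
      rw [← Finset.mul_sum] at hcap
      have hyy : 0 < y / (1 - y) := div_pos hy0 (by linarith)
      -- the sum of the new entries is at most the sum of the old entries
      have hle : ∑ l ∈ Finset.range (j + 1), (if (l ≤ j ∧ 2 * (l : ℝ) < t) then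
          f l h + θ * f a h * ((if l = 0 then (1 : ℝ) else 0) - (if l = a then (1 : ℝ) else 0)) else 0)
          ≤ ∑ l ∈ Finset.range (j + 1), f l h := by
        -- split off the transfer terms: they are `+θ f a h` at `l = 0` and `−θ f a h` at `l = a`
        have e1 : ∀ l ∈ Finset.range (j + 1), (if (l ≤ j ∧ 2 * (l : ℝ) < t) then
            f l h + θ * f a h * ((if l = 0 then (1 : ℝ) else 0) - (if l = a then (1 : ℝ) else 0)) else 0)
            = (if (l ≤ j ∧ 2 * (l : ℝ) < t) then f l h else 0)
              + θ * f a h * (if l = 0 then (1 : ℝ) else 0) - θ * f a h * (if l = a then (1 : ℝ) else 0) := by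
          intro l hl
          have hlj : l ≤ j := Nat.lt_succ_iff.1 (Finset.mem_range.1 hl)
          by_cases hlt : 2 * (l : ℝ) < t
          · rw [if_pos (show l ≤ j ∧ 2 * (l : ℝ) < t from ⟨hlj, hlt⟩),
              if_pos (show l ≤ j ∧ 2 * (l : ℝ) < t from ⟨hlj, hlt⟩)]
            ring
          · have hl0 : l ≠ 0 := by rintro rfl; push_cast at hlt; linarith
            have hla : l ≠ a := by rintro rfl; exact hlt hat
            rw [if_neg (fun h' => hlt h'.2), if_neg (fun h' => hlt h'.2), if_neg hl0, if_neg hla]; ring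
        rw [Finset.sum_congr rfl e1, Finset.sum_sub_distrib, Finset.sum_add_distrib, ← Finset.mul_sum, ← Finset.mul_sum,
          Finset.sum_ite_eq' (Finset.range (j + 1)) 0, if_pos (Finset.mem_range.2 (Nat.succ_pos j)),
          Finset.sum_ite_eq' (Finset.range (j + 1)) a, if_pos (Finset.mem_range.2 (Nat.lt_succ_of_le haj))]
        have : ∑ l ∈ Finset.range (j + 1), (if (l ≤ j ∧ 2 * (l : ℝ) < t) then f l h else 0)
            ≤ ∑ l ∈ Finset.range (j + 1), f l h :=
          Finset.sum_le_sum fun l _ => by split_ifs <;> linarith [hf0 l h]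
        linarith
      exact (mul_le_mul_of_nonneg_left hle hyy.le).trans hcap
    · -- a mid of `t`: no transfer term; rates are smaller at `t`; a `τ`-low mid carries no `τ`-flow
      simp only [if_neg hg, add_zero]
      have hhj : h ≤ j := by omega
      have ht2h : t ≤ 2 * (h : ℝ) := habs.resolve_left hg
      by_cases hτh : τ ≤ 2 * (h : ℝ)
      · have hcap := hfcap h hhN (Or.inr hτh)
        refine le_trans (Finset.sum_le_sum fun l hl => ?_) hcap
        have hlj : l ≤ j := Nat.lt_succ_iff.1 (Finset.mem_range.1 hl)
        by_cases hlt : 2 * (l : ℝ) < t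
        · rw [if_pos ⟨hlj, hlt⟩]
          rcases (hf0 l h).eq_or_lt with hz | hp
          · rw [← hz, mul_zero, mul_zero]
          · obtain ⟨_, _, _, hc⟩ := hfsupp l h hp
            have hlh : l < h := by
              rcases hc with hc | hc
              · omega
              · exact_mod_cast (show (l : ℝ) < h by linarith)
            exact mul_le_mul_of_nonneg_right (usage_le_of_target_le y t τ j l h hy0 hy1 htτ hlt hlh hc) hp.le
        · rw [if_neg (fun h' => hlt h'.2), mul_zero]
          rcases (hf0 l h).eq_or_lt with hz | hp
          · rw [← hz, mul_zero]
          · obtain ⟨_, hl2, _, hc⟩ := hfsupp l h hp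
            have hlh : l < h := by
              rcases hc with hc | hc
              · omega
              · exact_mod_cast (show (l : ℝ) < h by linarith)
            exact (mul_nonneg (usage_pos_of_compat y τ j l h hy0 hy1 hl2 hlh hc).le hp.le)
      · -- `h` is a low of `τ`: nothing is shipped into it
        have hz : ∀ l, f l h = 0 := by
          intro l
          by_contra hne
          obtain ⟨_, hl2, _, hc⟩ := hfsupp l h (lt_of_le_of_ne (hf0 l h) (Ne.symm hne))
          rcases hc with hc | hc
          · omega
          · linarith
        have : ∑ l ∈ Finset.range (j + 1), usage y t j l h * (if (l ≤ j ∧ 2 * (l : ℝ) < t) then f l h else 0) = 0 :=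
          Finset.sum_eq_zero fun l _ => by rw [hz l]; split_ifs <;> simp
        rw [this]
        exact hL0 h

/-! ### Criterion 2: every nonzero `t`-low other than `a` is mid-absorbed -/

/-- **THE LOW-TO-ZERO MOVE WHEN THE NONZERO LOWS RIDE THE MIDS.**  `0 < y < 1`, `t ≤ τ`, `a ≤ j < N`, `2a < t`; `L` with a flow
datum `f` at `(y, τ, j)` on `{0..N}` in which every nonzero `t`-low `l ≠ a` ships nothing to the giants and `a` ships at most `ε ≤ L a`
to the giants; the moved law `P = L + ε(δ₀ − δ_a)` a probability law on `{0..N}` (`P ≥ 0`, mass `1`) of mean `t` with `y·N ≤ t`.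
Then `P` has a flow at `(y, t, j)`: the mid pairs of the nonzero `t`-lows are kept (those of `a` scaled to its new mass `L a − ε`,
all cheaper at the smaller target), and the remainder — whose only charged low is `0` and whose mean is at least `t` times its mass
(`gateMoveBlob_remainder`, every kept pair having mean `≤ t`) — is shipped by the first-moment criterion `flowAtT_of_moment`.
[this work] -/
theorem flowAtT_lowToZero_of_midAbsorbed (y τ t ε : ℝ) (a j N : ℕ) (L : ℕ → ℝ) (f : ℕ → ℕ → ℝ)
    (hy0 : 0 < y) (hy1 : y < 1) (htτ : t ≤ τ) (haj : a ≤ j) (hat : 2 * (a : ℝ) < t) (hjN : j < N)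
    (hf : IsFlowAtT y τ j N L f) (hεa : ε ≤ L a)
    (hP0 : ∀ h, 0 ≤ L h + ε * ((if h = 0 then (1 : ℝ) else 0) - (if h = a then (1 : ℝ) else 0)))
    (hP1 : ∑ h ∈ Finset.range (N + 1), (L h + ε * ((if h = 0 then (1 : ℝ) else 0) - (if h = a then (1 : ℝ) else 0))) = 1)
    (hPt : ∑ h ∈ Finset.range (N + 1),
      (h : ℝ) * (L h + ε * ((if h = 0 then (1 : ℝ) else 0) - (if h = a then (1 : ℝ) else 0))) = t)
    (hta : y * (N : ℝ) ≤ t)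
    (hGa : ∑ h ∈ Finset.Ico (j + 1) (N + 1), f a h ≤ ε)
    (habs : ∀ l h, 1 ≤ l → l ≠ a → l ≤ j → 2 * (l : ℝ) < t → j + 1 ≤ h → f l h = 0) :
    FlowAtT y t j N (fun h => L h + ε * ((if h = 0 then (1 : ℝ) else 0) - (if h = a then (1 : ℝ) else 0))) := by
  classical
  obtain ⟨hf0, hfsupp, hfrow, hfcap⟩ := hf
  set P : ℕ → ℝ := fun h => L h + ε * ((if h = 0 then (1 : ℝ) else 0) - (if h = a then (1 : ℝ) else 0)) with hP
  have ht0 : 0 < t := by linarith [(Nat.cast_nonneg a : (0 : ℝ) ≤ a)]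
  have haτ : 2 * (a : ℝ) < τ := lt_of_lt_of_le hat htτ
  have hjN1 : j + 1 ≤ N + 1 := by omega
  -- the row of `a`: mid part `μa` and giant part `Ga`
  set Ga : ℝ := ∑ h ∈ Finset.Ico (j + 1) (N + 1), f a h with hGa_def
  set μa : ℝ := ∑ h ∈ Finset.range (j + 1), f a h with hμa_def
  have hμa0 : 0 ≤ μa := Finset.sum_nonneg fun h _ => hf0 a h
  have hrowa : μa + Ga = L a := by rw [hμa_def, hGa_def, Finset.sum_range_add_sum_Ico _ hjN1]; exact hfrow a haj haτ
  -- kept mass of `a` and the scaling factor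
  set K : ℝ := L a - ε with hK
  have hK0 : 0 ≤ K := by rw [hK]; linarith
  have hKμ : K ≤ μa := by rw [hK]; linarith
  obtain ⟨κ, hκ0, hκ1, hκμ⟩ : ∃ κ : ℝ, 0 ≤ κ ∧ κ ≤ 1 ∧ κ * μa = K := by
    rcases hμa0.eq_or_lt with hz | hpos
    · refine ⟨0, le_rfl, zero_le_one, ?_⟩
      have : K = 0 := le_antisymm (by rw [hz]; exact hKμ) hK0
      rw [this, zero_mul]
    · exact ⟨K / μa, div_nonneg hK0 hμa0, (div_le_one hpos).2 hKμ, div_mul_cancel₀ K hpos.ne'⟩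
  -- the partial flow: mid pairs of the nonzero `t`-lows, those of `a` scaled by `κ`
  set φ : ℕ → ℕ → ℝ := fun l m =>
    if (1 ≤ l ∧ l ≤ j ∧ 2 * (l : ℝ) < t ∧ m ≤ j) then (if l = a then κ * f a m else f l m) else 0 with hφ
  have hφ0 : ∀ l m, 0 ≤ φ l m := by
    intro l m
    simp only [hφ]
    split_ifs
    · exact mul_nonneg hκ0 (hf0 a m)
    · exact hf0 l m
    · exact le_rfl
  have hφle : ∀ l m, φ l m ≤ f l m := by
    intro l m
    simp only [hφ]
    split_ifs with h1 h2
    · rw [h2]; nlinarith [hf0 a m]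
    · exact le_rfl
    · exact hf0 l m
  -- a charged pair of `φ` is a charged mid pair of `f`
  have hφpos : ∀ l m, 0 < φ l m → (1 ≤ l ∧ l ≤ j ∧ 2 * (l : ℝ) < t ∧ m ≤ j) ∧ 0 < f l m := by
    intro l m hp
    have hc : 1 ≤ l ∧ l ≤ j ∧ 2 * (l : ℝ) < t ∧ m ≤ j := by
      by_contra hc; simp only [hφ, if_neg hc] at hp; exact lt_irrefl _ hp
    refine ⟨hc, ?_⟩
    simp only [hφ, if_pos hc] at hp
    by_cases hla : l = a
    · rw [if_pos hla] at hp
      rw [hla]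
      by_contra hle
      have : f a m = 0 := le_antisymm (not_lt.1 hle) (hf0 a m)
      rw [this, mul_zero] at hp
      exact lt_irrefl _ hp
    · rwa [if_neg hla] at hp
  have hφch : ∀ l m, 0 < φ l m → (1 ≤ l ∧ l ≤ j ∧ 2 * (l : ℝ) < t) ∧ m ≤ j ∧ τ < 2 * (m : ℝ) ∧ t < (l : ℝ) + m := by
    intro l m hp
    obtain ⟨⟨hl1, hlj, hlt, hmj⟩, hfp⟩ := hφpos l m hp
    obtain ⟨_, hl2, _, hc⟩ := hfsupp l m hfp
    have hc' : τ < (l : ℝ) + m := hc.resolve_left (by omega)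
    exact ⟨⟨hl1, hlj, hlt⟩, hmj, by linarith, by linarith⟩
  have hφsupp : ∀ l m, 0 < φ l m → l ≤ j ∧ 2 * (l : ℝ) < t ∧ m ≤ N ∧ (j + 1 ≤ m ∨ t < (l : ℝ) + m) := by
    intro l m hp
    obtain ⟨⟨_, hlj, hlt⟩, hmj, _, hc⟩ := hφch l m hp
    exact ⟨hlj, hlt, by omega, Or.inr hc⟩
  -- rows of `φ`
  have hrow_ne : ∀ l : ℕ, 1 ≤ l → l ≤ j → 2 * (l : ℝ) < t → l ≠ a →
      ∑ m ∈ Finset.range (N + 1), φ l m = L l := by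
    intro l hl1 hlj hlt hla
    rw [← hfrow l hlj (by linarith)]
    refine Finset.sum_congr rfl fun m hm => ?_
    have hmN : m ≤ N := Nat.lt_succ_iff.1 (Finset.mem_range.1 hm)
    by_cases hmj : m ≤ j
    · simp only [hφ, if_pos (show 1 ≤ l ∧ l ≤ j ∧ 2 * (l : ℝ) < t ∧ m ≤ j from ⟨hl1, hlj, hlt, hmj⟩), if_neg hla]
    · simp only [hφ, if_neg (show ¬ (1 ≤ l ∧ l ≤ j ∧ 2 * (l : ℝ) < t ∧ m ≤ j) from fun h' => hmj h'.2.2.2)]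
      exact (habs l m hl1 hla hlj hlt (by omega)).symm
  have hrow_a : 1 ≤ a → ∑ m ∈ Finset.range (N + 1), φ a m = K := by
    intro ha1
    rw [← hκμ, hμa_def, Finset.mul_sum, ← Finset.sum_range_add_sum_Ico _ hjN1]
    have hz : ∑ m ∈ Finset.Ico (j + 1) (N + 1), φ a m = 0 :=
      Finset.sum_eq_zero fun m hm => by
        have : ¬ (1 ≤ a ∧ a ≤ j ∧ 2 * (a : ℝ) < t ∧ m ≤ j) := fun h' => by
          have := (Finset.mem_Ico.1 hm).1; omega
        simp only [hφ, if_neg this]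
    rw [hz, add_zero]
    refine Finset.sum_congr rfl fun m hm => ?_
    have hmj : m ≤ j := Nat.lt_succ_iff.1 (Finset.mem_range.1 hm)
    simp only [hφ, if_pos (show 1 ≤ a ∧ a ≤ j ∧ 2 * (a : ℝ) < t ∧ m ≤ j from ⟨ha1, haj, hat, hmj⟩), if_true]
  -- `P` off `0` and `a`
  have hPoff : ∀ h, h ≠ 0 → h ≠ a → P h = L h := by
    intro h h0 ha
    simp only [hP, if_neg h0, if_neg ha, sub_self, mul_zero, add_zero]
  have hPa : 1 ≤ a → P a = K := by
    intro ha1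
    have : a ≠ 0 := by omega
    simp only [hP, if_neg this, if_true, hK]
    ring
  have hφrow : ∀ l : ℕ, 1 ≤ l → l ≤ j → 2 * (l : ℝ) < t → ∑ m ∈ Finset.range (N + 1), φ l m ≤ P l := by
    intro l hl1 hlj hlt
    by_cases hla : l = a
    · subst hla
      rw [hrow_a hl1, hPa hl1]
    · rw [hrow_ne l hl1 hlj hlt hla, hPoff l (by omega) hla]
  -- columns of `φ`
  have hφcol : ∀ h, h ≤ j → τ < 2 * (h : ℝ) → ∑ l ∈ Finset.range (j + 1), usage y t j l h * φ l h ≤ P h := by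
    intro h hhj hτh
    have hh0 : h ≠ 0 := by rintro rfl; push_cast at hτh; linarith
    have hha : h ≠ a := by rintro rfl; linarith
    rw [hPoff h hh0 hha]
    refine le_trans (Finset.sum_le_sum fun l _ => ?_) (hfcap h (by omega) (Or.inr hτh.le))
    rcases (hφ0 l h).eq_or_lt with hz | hp
    · rw [← hz, mul_zero]
      rcases (hf0 l h).eq_or_lt with hz' | hp'
      · rw [← hz', mul_zero]
      · obtain ⟨_, hl2, _, hc⟩ := hfsupp l h hp'
        have hlh : l < h := by
          rcases hc with hc | hc
          · omega
          · exact_mod_cast (show (l : ℝ) < h by linarith)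
        exact mul_nonneg (usage_pos_of_compat y τ j l h hy0 hy1 hl2 hlh hc).le hp'.le
    · obtain ⟨⟨_, hlj, hlt⟩, _, _, hc⟩ := hφch l h hp
      obtain ⟨_, hfp⟩ := hφpos l h hp
      obtain ⟨_, _, _, hcτ⟩ := hfsupp l h hfp
      have hlh : l < h := by exact_mod_cast (show (l : ℝ) < h by linarith)
      calc usage y t j l h * φ l h ≤ usage y τ j l h * φ l h :=
            mul_le_mul_of_nonneg_right (usage_le_of_target_le y t τ j l h hy0 hy1 htτ hlt hlh hcτ) hp.le
        _ ≤ usage y τ j l h * f l h :=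
            mul_le_mul_of_nonneg_left (hφle l h) (usage_pos_of_compat y τ j l h hy0 hy1 (by linarith) hlh hcτ).le
  -- the remainder
  obtain ⟨hR0, hRrow, hRcol, hRmean⟩ := gateMoveBlob_remainder y t τ j N P φ hy0 hy1 htτ hjN hP0 hP1 hPt hta
    hφ0 hφch hφrow hφcol
  set Rem : ℕ → ℝ := fun h => P h - ∑ m ∈ Finset.range (N + 1), φ h m
    - ∑ l ∈ Finset.range (j + 1), usage y t j l h * φ l h with hRem
  -- the remainder has no nonzero low
  have hRlow : ∀ l, 1 ≤ l → l ≤ j → 2 * (l : ℝ) < t → Rem l = 0 := by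
    intro l hl1 hlj hlt
    have hc : ¬ (l ≤ j ∧ τ < 2 * (l : ℝ)) := fun h' => by linarith [h'.2]
    simp only [hRem]
    rw [hRcol l hc, sub_zero]
    by_cases hla : l = a
    · subst hla
      rw [hrow_a hl1, hPa hl1, sub_self]
    · rw [hrow_ne l hl1 hlj hlt hla, hPoff l (by omega) hla, sub_self]
  obtain ⟨g', hg'⟩ := flowAtT_of_moment y t j N Rem hy0 hy1 ht0 hR0 hRlow hta hRmean
  exact ⟨_, isFlowAtT_of_partial hφ0 hφsupp hg'⟩

end LawDec

end Quant

end Summit.CriticalPhenomena.PercolationContinuityZ3.Theorems
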